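import Literature.AnabelianGeometry.EtaleTheta.GalSectCuspPairTorsors
import HarnessLib

/-!
# [GalSect] §4 / Def. 4.1 for abstract cuspidal pairs: orbit structures and transport — proof-only
# companion of `GalSectCuspPairTorsors.lean`

Mochizuki, *Galois sections in absolute anabelian geometry* [GalSect], Nagoya Math. J. **179** (2005),
§4 p.33, Def. 4.1 (i)(ii) pp.33–34 [cite: MochizukiGalSect2005, Def 4.1 p.33]; used by [EtTh] Cor. 2.8 (ii)
"preserved by `γ`" [cite: MochizukiEtTh2009, Cor 2.8 (ii) p.42].  abc-iut cell, layer L2, ROW (B)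
companion (seat abc-iut-w5-d062 gen 2).  PROOF-ONLY (no definitions, no named facts):

* torsor algebra of `CuspPair.TorsorData`: `act_eq_self_iff`, `act_bijective`, `exists_act_eq`;
  `isStructure_orbit` (the `B`-orbit of any class IS a `B`-structure — structures EXIST),
  `IsStructure.nonempty`, `IsStructure.eq_orbit_of_mem` (a structure is the orbit of each member),
  `IsSubStructure.mono` in the ambient structure;
* classes and members: `SplittingClass.mk_eq_mk_iff`, `mem_members_iff`, `members_subset_splittings`;
* transport: `map_D`, `PreservedBy.refl` (the identity preserves every structure),
  `image_members_subset_splittings_map` (images of members are splittings of the image pair).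

HONEST FRAMING: elementary; [GalSect]/[EtTh] refereed; nothing bears on [IUTchIII] Cor. 3.12.
-/

namespace Literature.AnabelianGeometry.EtaleTheta

namespace GalSect

namespace CuspPair

open scoped Pointwise

variable {G : Type*} [Group G] [TopologicalSpace G] {P : CuspPair G}

/-! ### Classes and members -/

/-- Two splittings have the same class iff they are `I`-conjugate. [cite: MochizukiGalSect2005, §4 p.33] -/
theorem SplittingClass.mk_eq_mk_iff {S T : Subgroup G} (hS : S ∈ P.splittings) (hT : T ∈ P.splittings) :
    SplittingClass.mk P S hS = SplittingClass.mk P T hT ↔ P.InertiaConj S T :=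
  Quotient.eq (r := P.splittingSetoid)

/-- Membership in `members R`. [cite: MochizukiEtTh2009, Rmk 2.9.2 p.43] -/
theorem mem_members_iff (R : Set P.SplittingClass) (S : Subgroup G) :
    S ∈ P.members R ↔ ∃ hS : S ∈ P.splittings, SplittingClass.mk P S hS ∈ R :=
  Iff.rfl

/-- Members are splittings. [cite: MochizukiGalSect2005, §4 p.33] -/
theorem members_subset_splittings (R : Set P.SplittingClass) : P.members R ⊆ P.splittings :=
  fun _ ⟨hS, _⟩ => hS

/-- `members` is monotone. [cite: MochizukiGalSect2005, §4 p.33] -/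
theorem members_mono {R R' : Set P.SplittingClass} (h : R ⊆ R') : P.members R ⊆ P.members R' :=
  fun _ ⟨hS, hmem⟩ => ⟨hS, h hmem⟩

/-- Every class of `R` is met by `members R`. [cite: MochizukiGalSect2005, §4 p.33] -/
theorem exists_members_of_mem {R : Set P.SplittingClass} {c : P.SplittingClass} (hc : c ∈ R) :
    ∃ S ∈ P.members R, ∃ hS : S ∈ P.splittings, SplittingClass.mk P S hS = c := by
  obtain ⟨S, hS, rfl⟩ := SplittingClass.exists_rep P c
  exact ⟨S, ⟨hS, hc⟩, hS, rfl⟩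

/-! ### Torsor algebra -/

namespace TorsorData

variable {A : Type*} [Group A] (T : P.TorsorData A)

/-- Freeness: `a · c = c ↔ a = 1`. [cite: MochizukiGalSect2005, §4 p.33] -/
theorem act_eq_self_iff (a : A) (c : P.SplittingClass) : T.act a c = c ↔ a = 1 := by
  constructor
  · intro h
    obtain ⟨a₀, -, huniq⟩ := T.existsUnique_act_eq c c
    rw [huniq a h, huniq 1 (T.act_one c)]
  · rintro rfl
    exact T.act_one c

/-- Transitivity. [cite: MochizukiGalSect2005, §4 p.33] -/
theorem exists_act_eq (c c' : P.SplittingClass) : ∃ a : A, T.act a c = c' :=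
  (T.existsUnique_act_eq c c').exists

/-- Each `a` acts bijectively. [cite: MochizukiGalSect2005, §4 p.33] -/
theorem act_bijective (a : A) : Function.Bijective (T.act a) := by
  refine Function.bijective_iff_has_inverse.mpr ⟨T.act a⁻¹, fun c => ?_, fun c => ?_⟩
  · rw [← T.act_mul, inv_mul_cancel, T.act_one]
  · rw [← T.act_mul, mul_inv_cancel, T.act_one]

/-- **Structures exist**: the `B`-orbit of any class is a `B`-structure (Def. 4.1 (i)/(ii) non-vacuity:
at every class there is an integral / discrete / `μ_n`-structure through it).
[cite: MochizukiGalSect2005, Def 4.1 (ii) p.34] -/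
theorem isStructure_orbit (B : Subgroup A) (c : P.SplittingClass) :
    T.IsStructure B {c' | ∃ b ∈ B, c' = T.act b c} :=
  ⟨c, ⟨1, B.one_mem, (T.act_one c).symm⟩, rfl⟩

/-- A structure is nonempty. [cite: MochizukiGalSect2005, Def 4.1 (i) p.34] -/
theorem IsStructure.nonempty {B : Subgroup A} {R : Set P.SplittingClass} (h : T.IsStructure B R) :
    R.Nonempty := by
  obtain ⟨c, hc, -⟩ := h
  exact ⟨c, hc⟩

/-- A `B`-structure is the `B`-orbit of EACH of its members. [cite: MochizukiGalSect2005, Def 4.1 (i) p.34] -/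
theorem IsStructure.eq_orbit_of_mem {B : Subgroup A} {R : Set P.SplittingClass} (h : T.IsStructure B R)
    {c : P.SplittingClass} (hc : c ∈ R) : R = {c' | ∃ b ∈ B, c' = T.act b c} := by
  obtain ⟨c₀, -, rfl⟩ := h
  obtain ⟨b₀, hb₀, rfl⟩ := hc
  ext c'
  constructor
  · rintro ⟨b, hb, rfl⟩
    exact ⟨b * b₀⁻¹, B.mul_mem hb (B.inv_mem hb₀), by rw [← T.act_mul, inv_mul_cancel_right]⟩
  · rintro ⟨b, hb, rfl⟩
    exact ⟨b * b₀, B.mul_mem hb hb₀, by rw [T.act_mul]⟩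

/-- Two members of one `B`-structure differ by an element of `B`. [cite: MochizukiGalSect2005, Def 4.1 (i) p.34] -/
theorem IsStructure.exists_act_eq_of_mem {B : Subgroup A} {R : Set P.SplittingClass}
    (h : T.IsStructure B R) {c c' : P.SplittingClass} (hc : c ∈ R) (hc' : c' ∈ R) :
    ∃ b ∈ B, c' = T.act b c := by
  rw [h.eq_orbit_of_mem T hc] at hc'
  exact hc'

/-- A `B`-structure inside a `B'`-structure for `B ≤ B'`: the orbit of a member under the smaller group
lies in the bigger structure (e.g. a `μ_n`-structure generates inside the integral structure it refines).
[cite: MochizukiGalSect2005, Cor 4.12 p.43] -/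
theorem IsStructure.orbit_subset {B B' : Subgroup A} (hBB' : B ≤ B') {R' : Set P.SplittingClass}
    (h' : T.IsStructure B' R') {c : P.SplittingClass} (hc : c ∈ R') :
    {c' | ∃ b ∈ B, c' = T.act b c} ⊆ R' := by
  rintro c' ⟨b, hb, rfl⟩
  rw [h'.eq_orbit_of_mem T hc]
  exact ⟨b, hBB' hb, rfl⟩

/-- **Sub-structures exist** inside any structure for a smaller group: through each member of a
`B'`-structure there is a `B`-structure contained in it (`B ≤ B'`) — the shape of [GalSect] Cor. 4.12 /
[EtTh] Cor. 2.8 (ii) conclusions is never vacuous for lack of orbits; their content is WHICH orbit.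
[cite: MochizukiGalSect2005, Cor 4.12 p.43] -/
theorem exists_isSubStructure {B B' : Subgroup A} (hBB' : B ≤ B') {R' : Set P.SplittingClass}
    (h' : T.IsStructure B' R') : ∃ R, T.IsSubStructure B R' R := by
  obtain ⟨c, hc⟩ := h'.nonempty T
  exact ⟨_, T.isStructure_orbit B c, h'.orbit_subset T hBB' hc⟩

end TorsorData

/-! ### Transport -/

/-- `map` on the decomposition group. [cite: MochizukiEtTh2009, Cor 2.8 (ii) p.42] -/
theorem map_D {G' : Type*} [Group G'] [TopologicalSpace G'] (Γ : G ≃ₜ* G') :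
    (P.map Γ).D = P.D.map Γ.toMulEquiv.toMonoidHom :=
  rfl

/-- Images of members are splittings of the image pair. [cite: MochizukiEtTh2009, Cor 2.8 (ii) p.42] -/
theorem image_members_subset_splittings_map {G' : Type*} [Group G'] [TopologicalSpace G']
    (Γ : G ≃ₜ* G') (R : Set P.SplittingClass) :
    (fun S => S.map Γ.toMulEquiv.toMonoidHom) '' P.members R ⊆ (P.map Γ).splittings := by
  rintro _ ⟨S, hS, rfl⟩
  exact P.map_mem_splittings Γ (P.members_subset_splittings R hS)

/-- **The identity preserves every structure** (`PreservedBy` is reflexive at `Γ = id`).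
[cite: MochizukiEtTh2009, Cor 2.8 (ii) p.42] -/
theorem PreservedBy.refl [IsTopologicalGroup G] (R : Set P.SplittingClass) :
    P.PreservedBy P (ContinuousMulEquiv.refl G) R R := by
  constructor
  · change P.D.map (MulEquiv.refl G).toMonoidHom = P.D
    exact Subgroup.map_id P.D
  · ext S
    simp only [Set.mem_image]
    constructor
    · rintro ⟨S', hS', rfl⟩
      change S'.map (MulEquiv.refl G).toMonoidHom ∈ _
      rwa [show S'.map (MulEquiv.refl G).toMonoidHom = S' from Subgroup.map_id S']
    · intro hS
      refine ⟨S, hS, ?_⟩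
      change S.map (MulEquiv.refl G).toMonoidHom = S
      exact Subgroup.map_id S

end CuspPair

end GalSect

end Literature.AnabelianGeometry.EtaleTheta
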